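import Summits.CriticalPhenomena.PercolationContinuityZ3.Theorems.PercNearOneGluingNoHeavyQuantLightResidDECLaw
import HarnessLib

/-!
# QUANT lane R8, T-DEC: THE ORACLE (LAW-LEVEL) FORM OF THE LIGHT NODE — `LightResidDECOracle`: for sibling laws that are `SDECLight` at
# their sub-floors (the induction's light oracle, as a hypothesis on the laws; no tree structure) the top-level residual is DEC at the capped
# floor at every layer; `LightResidDECLaw ⟹ LightResidDECOracle ⟹ LightSiblingStep ⟹ Quant.FarTreeRow` (arm-1 gen 51, architect)

builds on p205010 (kernel theorem, internal audit signed; external expert review pending)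

Statement + support file (`--supports stmt-CriticalPhenomena-4575`), QUANT lane seat prim-quant-arm-1 (gen 51, architect), rung R8 of
`run/shared/lean/prim/quant/LADDER.md`; memo `run/shared/lean/prim/quant/prim-quant-arm-1-g51/ARCH-G51.md`.  One law-level binder
(`Sib.OracleOK`, `SibFamOracle₃`) and one `@[conjecture]` (`LightResidDECOracle`); theorems with standard axioms, no sorries.

WHY (ARCH-G51 §1–§2).  The pure form `LightResidDECLaw` (✓ p455322, arm-1 g50) quantifies over ARBITRARY top-affordable sibling laws
(`Sib.AffOK`: sub-floor `x₁` with `x₁·M ≤ mean`) and is FALSE IN THE KERNEL: prim-quant-census-1 g24's `not_lightResidDECLaw` (✓ p461743), with the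
loopholes "companions of positive top" and "composite companions" closed by `not_lightResidDECOn_affOK_relays` (✓ p462624) and
`not_lightResidDECOn_affOK_composite` (✓ p465014; ARM-REF g158/g159 countersigned) — in each witness a bimodal far-giant law `{c: 1−e, N: e}` sits at
the sub-floor `x₁ = mean/M > e`, which no tree realisation of the law has (tree floor `e`), and the residual violates the FAR ROW at a dominant gap
layer (`tail_ge_of_decAt`).  Independently this seat (and ARM-REF g158, finding F1) found that the per-layer LP behind ARCH-G50's "0 failures" counts
(`lightcap5.flow_lp`) was a RELAXATION of the kernel `LawDec.FlowAtT` — it let a `T`-compatible giant `h ≥ j′+1` absorb at the light credit gate,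
although rule (G) of `LawDec.ValidAt` gives giants the floor gate only — so those counts were void as stated.  RE-RUN WITH THE KERNEL-FAITHFUL LP
(`g = y` for `h ≥ j′+1`; bundle `run/shared/lean/prim/quant/prim-quant-arm-1-g51/kit-faithful/`): the PURE form fails (kit j258620: 215 664 arbitrary-law
(forest, a) pairs, 142 FAIL, all with far giants at `x₁ = mean/M`), while EVERY TREE-BUILT census keeps 0 failures — kit j258625 (light-cap census,
252 930 pairs: capped floor criteria 252 805 / `DECFree` 125 / per-layer-only 0 / FAIL 0; natural floor per-layer-only 30 / FAIL 0) and kit j258622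
(tree-built near-sure giants, 7 680 rows: criteria 2 585 / `DECFree` 909 / per-layer-only 346 / FAIL 0 — identical to j255677, so the layer-free
`LightResidDECFree` stays numerically refuted on tree-built data and the per-layer node stands).  The failing pure instances violate the induction's
own oracle: `{1: ½, N: ½}` is NOT `SDECLight` at `x₁ = (N+1)/(2N)` (gate `q = 7/10`, any layer `1 ≤ j′ < N`: the lows `{0,1}` of mass `1 − q/2` must
ride the giant `N` at rate `y/(1−y)`, `y = q·x₁`, exceeding its mass `q/2` exactly when `x₁ > ½`).  Hence — census-1 g24's REPAIR and ARM-REF g158's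
R10 — the honest law-level statement of the open core keeps the ORACLE as a hypothesis on the sibling laws and nothing else:
* `Sib.OracleOK x s` := `s.AffOK x ∧ SDECLight s.x₁ s.M s.ρ`;  `SibFamOracle₃`;  `Sib.OracleOK.affOK`, `sibFamAff₃_of_sibFamOracle₃`;
* **`@[conjecture] LightResidDECOracle := LightResidDECOn SibFamOracle₃`**;
* **`lightResidDECOracle_of_law : LightResidDECLaw → LightResidDECOracle`** (so a proof of the pure form would still have sufficed — it is false);
* **`lightSiblingStep_of_lightResidDECOracle : LightResidDECOracle → LightSiblingStep`** (in the light sibling step the members of a tree-OK list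
  are aff-OK by `Sib.TreeOK.affOK` and `SDECLight` by the step's oracle, `sdecLight_members_of_oracle`; then `sdecLight_flaw_of_lightResidDECAt`);
* **`Quant.farTreeRow_of_lightResidDECOracle : LightResidDECOracle → FarTreeRow`** (unconditional).
`LightResidDECOracle ⟹ LightResidDEC` is NOT claimed (it would need `SDECLight` of tree-built laws, the open induction itself); both imply
`LightSiblingStep`.

HONEST STATUS: `LightResidDECOracle` is EVIDENCE-LEVEL: every tree-built census instance is an instance (kernel-faithful re-runs kit j258625 /
j258622: 260 610 exact (forest, a) pairs / rows, 0 failures; the earlier ≈ 8·10⁵ pairs of ARCH-G50 only after the faithful re-run, see above);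
arbitrary `SDECLight` laws beyond tree-built ones not yet sampled at their oracle floors.  `LightResidDECLaw` REFUTED (kernel, census-1 g24);
`LightResidDEC`, `LightSiblingStep`, `SiblingStep`, `ResidDEC`, `FarTreeRow` OPEN.  RATE class log\* / honest sentence of
`run/shared/lean/prim/quant/README.md` unchanged.  [this work]; refutations: prim-quant-census-1 g24; F1: this seat and ARM-REF g158.  Nothing here is
cited as a published result.  The gluing rows served [cite: KozmaNitzan2024, Conjecture 3 (p. 15)]; product measure [cite: Grimmett1999, §1.3 p. 10].
-/

noncomputable section

open scoped BigOperators

namespace Summit.CriticalPhenomena.PercolationContinuityZ3.Theorems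
namespace Quant
namespace LawDec

open Finset

/-- **oracle-level validity of sibling data at floor `x`**: aff-OK (`0 < q < 1`, `ρ` a probability law on `{0..M}`, sub-floor `0 < x₁`,
`x ≤ q·x₁`, `x₁·M ≤ mean ρ`) AND the sub-forest law is `SDECLight` at its sub-floor (the light induction's oracle, as a hypothesis on the law).
No tree structure. [this work] -/
def Sib.OracleOK (x : ℝ) (s : Sib) : Prop :=
  s.AffOK x ∧ SDECLight s.x₁ s.M s.ρ

/-- oracle-OK data is aff-OK. [this work] -/
theorem Sib.OracleOK.affOK {x : ℝ} {s : Sib} (h : s.OracleOK x) : s.AffOK x := h.1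

/-- **the oracle family**: lists of at least three oracle-OK siblings at floor `x`. [this work] -/
def SibFamOracle₃ (x : ℝ) (L : List Sib) : Prop :=
  (∀ s ∈ L, s.OracleOK x) ∧ 3 ≤ L.length

/-- `SibFamOracle₃ ⊆ SibFamAff₃`. [this work] -/
theorem sibFamAff₃_of_sibFamOracle₃ {x : ℝ} {L : List Sib} (h : SibFamOracle₃ x L) : SibFamAff₃ x L :=
  ⟨fun s hs => (h.1 s hs).affOK, h.2⟩

/-- a tree-OK list whose members' sub-forest laws are `SDECLight` at their sub-floors is an oracle-OK list. [this work] -/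
theorem sibFamOracle₃_of_treeOK {x : ℝ} {L : List Sib} (hL : ∀ s ∈ L, s.TreeOK x) (hS : ∀ s ∈ L, SDECLight s.x₁ s.M s.ρ)
    (hk : 3 ≤ L.length) : SibFamOracle₃ x L :=
  ⟨fun s hs => ⟨(hL s hs).affOK, hS s hs⟩, hk⟩

/-- **CONJECTURE `LIGHT RESID-DEC, ORACLE FORM` (arm-1 g51 ARCH-G51 §2; the repair of the refuted pure form `LightResidDECLaw` named by
prim-quant-census-1 g24 (`…QuantLightResidDECLawRefutation`) and ARM-REF g158 (R10)).**  For every list of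
`k ≥ 3` siblings `(qᵢ, ρᵢ)` with `0 < qᵢ < 1`, `ρᵢ` a probability law on `{0..Mᵢ}` with a sub-floor `0 < x₁ᵢ`, `x₁ᵢ·Mᵢ ≤ mean ρᵢ`, whose law is
`SDECLight` at `x₁ᵢ` (every gating `gate ρᵢ q` DEC at floor `min (q·x₁ᵢ) (1/2)` at every layer below `Mᵢ`), at a forest floor `0 < x < 1` with
`x ≤ qᵢ·x₁ᵢ`, and every outer gate `0 < a < 1`: the top-level residual `resid a (wco a L) L` is DEC at the CAPPED floor `min (a·x) (1/2)` at every
layer below `ftop L` (`LightResidDECAt x a L`).  KERNEL FACTS: `LightResidDECLaw ⟹ LightResidDECOracle ⟹ LightSiblingStep ⟹ Quant.FarTreeRow`.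
EVIDENCE: every tree-built census instance of `LightResidDEC` under the KERNEL-FAITHFUL per-layer LP (kit j258625: 252 930 (forest, a) pairs, kit
j258622: 7 680 giant rows; 0 failures); the pure form's kernel witnesses and all 142 failures of kit j258620 violate the oracle hypothesis.
builds on p205010 (kernel theorem, internal audit signed; external expert review pending).
[this work] [status: open] -/
@[conjecture] def LightResidDECOracle : Prop :=
  LightResidDECOn SibFamOracle₃

/-- **`LightResidDECLaw ⟹ LightResidDECOracle`** (the refuted pure form was stronger). [this work] -/
theorem lightResidDECOracle_of_law (h : LightResidDECLaw) : LightResidDECOracle :=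
  LightResidDECOn.mono h fun _ _ hf => sibFamAff₃_of_sibFamOracle₃ hf

/-- **`LightResidDECOracle ⟹ LightSiblingStep`**: in the light sibling step the members of the forest's sibling list are tree-OK (hence aff-OK)
and `SDECLight` at their sub-floors by the step's oracle (`sdecLight_members_of_oracle`); the oracle form then gives `LightResidDECAt` at every
outer gate, and `sdecLight_flaw_of_lightResidDECAt` concludes. [this work] -/
theorem lightSiblingStep_of_lightResidDECOracle (h : LightResidDECOracle) : LightSiblingStep := by
  intro x n M k μ hk hF hO
  obtain ⟨L, hL, hn, hM, hμ, hkL⟩ := exists_list_of_compForestN hF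
  subst hn hM hμ hkL
  have hx0 : 0 < x := hF.floor.1
  have hx1 : x < 1 := hF.floor.2
  have hS : ∀ s ∈ L, SDECLight s.x₁ s.M s.ρ := sdecLight_members_of_oracle L hL hO
  exact sdecLight_flaw_of_lightResidDECAt hx0 L hL hS (by omega)
    (h x L hx0 hx1 (sibFamOracle₃_of_treeOK hL hS hk))

end LawDec

/-- **`LightResidDECOracle ⟹ Quant.FarTreeRow`, UNCONDITIONALLY.** [this work] -/
theorem farTreeRow_of_lightResidDECOracle (h : LawDec.LightResidDECOracle) : FarTreeRow :=
  farTreeRow_of_lightSiblingStep (LawDec.lightSiblingStep_of_lightResidDECOracle h)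

end Quant
end Summit.CriticalPhenomena.PercolationContinuityZ3.Theorems
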